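import Summits.QuantumFields.BalabanUV.Beta.D1BFx.Assembly
import Summits.QuantumFields.BalabanUV.Beta.D1BFx.ReducedKernelSandwich
import Summits.QuantumFields.BalabanUV.Beta.D1BFx.GhostKernelComplete

/-!
# `BalabanUV.Beta.D1BFx.AssemblySlots` — road «BF-x» for binder row D1, leaf A7 (instances): THE SLOTS (F) AND (CONV) OF `D1BFx.Assembly` ARE
# THEOREMS FOR THE LANDED FINE-LOOP PIECES — the reduced gluon kernel `TOfRed n a S (tableRed n Wf)` (A4 END `ReducedKernelSandwich`) and the
# completed ghost kernel of record `GhostKernelComplete.PghQ` (T7-gh v1.2; on its Ward ray with NO hypothesis beyond `Odd n`, `0 < a`)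

HONEST DEPENDENCY (page 1, mandatory): continuum YM on T⁴ ⇐ BetaPertH ∧ nine spine estimates (0/9 proved); BetaPertH ⇐ (D1) ∧ (D4) ∧
CAP+tail; G-an2-4 gates asym, D1 and NE2/3/4.  HONEST FRAMING (cell contract, verbatim): «discharging `BetaPertH` makes Bałaban's UV
stability UNCONDITIONAL — a real constructive-QFT result; it is NOT the continuum limit and NOT the Clay problem.»  THIS MODULE DISCHARGES
NOTHING of the wall: [folklore] bookkeeping BY NAME over landed modules — `D1BFx.Assembly` (the junction `avgM2 ↔ Σ_b wt·fullSum`), leaf-01's A4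
END `ReducedKernelSandwich.secondMoment_TOfRed_eq` / `absMoment₂_baseKer_fineHess`, leaf-02-g2's `GhostKernelComplete.secondMoment_PghQ_ray_eq` /
`bondSecondMoment_PghQ_eq_avgM2_of_wardRows`, leaf-04-g2's `GhostKernelRooted.biLoc_SghAt_ctr`, leaf-01-g2's
`ReducedKernelSandwichLeg.absMoment₂_baseKer_fineHessA`, the typer's `GhostLeg.spr_Ggh`.  No `def`, no `Prop` minted, nothing printed asserted,
0 sorry.  0 wall binders instantiated; NOT D1, NOT `BetaPertH`, NOT continuum, NOT Clay.

ABSOLUTE RULE (cell charter, verbatim): «No internally-minted statement may enter as a cited fact. Every hypothesis is either kernel-proved in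
this package or a verbatim quotation of a PUBLISHED theorem with page reference. The manuscript(s) under audit are NOT citable for their own
disputed steps — they are the thing under adjudication; programme-internal (2001/route/tribunal) claims are never citable.»

WHY (skeleton v1.5 node A7; `D1BFx.Assembly` header).  `Assembly.defect_eq_of_slots` / `hT_of_slots` derive the road's target T from typed slots;
slot (F) says «the (1.22)-moment of each fine-loop piece IS the uniform base-point average over the residue sites `[0,n)⁴` of the punctured full
sums of an explicit fine integrand», slot (CONV) says those integrands have convergent punctured partial sums.  THIS FILE proves (F) and (CONV)
at every fixed block size `n` for the two LANDED fine-loop pieces of the road, in EXACTLY the shape `Assembly` consumes: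
* §1 the fixed-`n` junction `secondMoment_eq_avg_fullSum` (a piece whose moment is `n⁻⁸·avgM2 n Q` with absolutely second-moment-summable
  base-point kernels satisfies (F) with `Bset n = [0,n)⁴`, `wt = n⁻⁴`, `Kf n b w = n⁻⁸·w_μw_ν·baseKer Q b w`) and `conv_of_absMoment₂`;
* §2 THE REDUCED GLUON PIECE `TOfRed n a S (tableRed n Wf)` (T7-gl `GluonKernel.Pgl … (tableRed n Wbf)` is the instance `S := SbfBal …`): (F) GIVEN
  the hypotheses of leaf-01's A4 END VERBATIM — the leg binder `Spr (Ga n a)` (T1's B5 Prop. 1.2 content, not in the tree), the binder-free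
  localisation/covariance/symmetry sockets of the stencils (`GluonKernelSectors.exists_biLoc_*`, T4/T5 sockets), and the Ward rows `hrow` / parity
  first moments `hT1` of `fineHess` (A3.b / R5-(T1) inputs) — `hF_TOfRed`; (CONV) from `Spr` + localisation only — `conv_TOfRed`;
* §3 THE GHOST PIECE OF RECORD `PghQ n a x₀ cK cQ`: (F) for all weights GIVEN the Ward rows (`hF_PghQ_of_wardRows`, `Odd n`), and ON THE WARD RAY
  `(x₀, cK, cQ) = (−c, c·n², c·a)` with NO hypothesis beyond `Odd n`, `0 < a` (`hF_PghQ_ray`); (CONV) for all weights (`conv_PghQ`, `0 < a` only).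
So for the ghost sector on its Ward ray the slots (F)/(CONV) of A7 are CLOSED in the tree; for the gluon sector they are closed modulo EXACTLY
the named inputs of the A4 END.  What remains OPEN for T is unchanged and now typed: (K) kernel-level K-R1∘K-R2, (SPLIT) A0∘A1.ii, (REST) A3.a/b,
(U) A5.1 (see `Assembly` header).  Loop weights / `n`-power normalisations (`ω i n`) are NOT applied here (they live in slot (K)).
Unit `b2b-balaban-beta-d1-p2` (road owner, gen 2); `LEAVES-BFx.md` row A7.
-/

open Finset Filter Topology
open scoped BigOperators
open Literature.MathematicalPhysics.QuantumFieldTheory.Balaban1983to89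
open Literature.MathematicalPhysics.QuantumFieldTheory.Balaban1983to89.Beta
open WindowIdentification (fullSum psum)
open DyadicShell (Pt toReal)
open ExpKernelCalculus (Site MKer BiLoc shiftK)
open DecimatedMomentSummable (AbsMoment₂)
open DressedMomentNormalisation (resSite)
open Summit.QuantumFields.BalabanUV.Beta.TameKernelCalculus (Spr)
open Summit.QuantumFields.BalabanUV.Beta.D1BFx.MomentTransferPeriodic (Ker₂ baseKer)
open Summit.QuantumFields.BalabanUV.Beta.D1BFx.MomentTransferPeriodicEntry (avgM2)
open Summit.QuantumFields.BalabanUV.Beta.D1BFx.GluonLeg (Ga)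
open Summit.QuantumFields.BalabanUV.Beta.D1BFx.ReducedKernel (StencilR TOfRed)
open Summit.QuantumFields.BalabanUV.Beta.D1BFx.DressedTadpoleTable (Table₂R tableRed)
open Summit.QuantumFields.BalabanUV.Beta.D1BFx.ReducedKernelSandwich (fineHess secondMoment_TOfRed_eq absMoment₂_baseKer_fineHess)
open Summit.QuantumFields.BalabanUV.Beta.D1BFx.ReducedKernelSandwichLeg (absMoment₂_baseKer_fineHessA)
open Summit.QuantumFields.BalabanUV.Beta.D1BFx.GhostLeg (Ggh spr_Ggh)
open Summit.QuantumFields.BalabanUV.Beta.D1BFx.GhostKernelRooted (biLoc_SghAt_ctr)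
open Summit.QuantumFields.BalabanUV.Beta.D1BFx.GhostKernelComplete (PghQ fineHessGhQ fineHessGhQ_eq biLoc_WghAt_ctr secondMoment_PghQ_ray_eq
  bondSecondMoment_PghQ_eq_avgM2_of_wardRows)
open Summit.QuantumFields.BalabanUV.Beta.D1BFx.Assembly (avgM2_eq_sum_fullSum sum_image_resSite exists_tendsto_psum_weight_mul
  exists_tendsto_psum_const_mul)

namespace Summit.QuantumFields.BalabanUV.Beta.D1BFx.AssemblySlots

/-! ## §1 The fixed-`n` junction -/

section Junction

variable {n : ℕ}

/-- [folklore] **SLOT (F) AT A FIXED BLOCK SIZE**: a piece whose (1.22)-moment is `n⁻⁸·avgM2 n Q μ ν` (the shape of every K-R5 END of the road)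
with absolutely second-moment-summable base-point kernels has its (1.22)-moment EQUAL to the uniform base-point average over the residue sites of
the punctured full sums of `w ↦ n⁻⁸·w_μw_ν·baseKer Q b w`. -/
theorem secondMoment_eq_avg_fullSum {P : B12Beta.Kernel 4} {Q : Ker₂ 4} {μ ν : Fin 4}
    (hP : ∑' z : Site 4, P μ ν z * (z μ : ℝ) * (z ν : ℝ) = ((n : ℝ) ^ 8)⁻¹ * avgM2 n Q μ ν)
    (hQ : ∀ r : Fin 4 → Fin n, AbsMoment₂ (baseKer Q (resSite r))) :
    B12Beta.secondMoment P μ ν =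
      ∑ b ∈ (univ : Finset (Fin 4 → Fin n)).image resSite, ((n : ℝ) ^ 4)⁻¹ *
        fullSum (fun w : Pt => ((n : ℝ) ^ 8)⁻¹ * (toReal w μ * toReal w ν * baseKer Q b w)) := by
  rw [B12Beta.secondMoment, hP, avgM2_eq_sum_fullSum Q hQ μ ν, sum_image_resSite, mul_sum]
  refine sum_congr rfl fun r _ => ?_
  rw [WindowIdentification.fullSum_const_mul _ (exists_tendsto_psum_weight_mul (hQ r) μ ν)]
  ring

/-- [folklore] **SLOT (CONV) AT A FIXED BLOCK SIZE** from the absolute second moments of the base-point kernels. -/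
theorem conv_of_absMoment₂ {Q : Ker₂ 4} (hQ : ∀ r : Fin 4 → Fin n, AbsMoment₂ (baseKer Q (resSite r))) (μ ν : Fin 4) :
    ∀ b ∈ (univ : Finset (Fin 4 → Fin n)).image resSite,
      ∃ B, Tendsto (psum (fun w : Pt => ((n : ℝ) ^ 8)⁻¹ * (toReal w μ * toReal w ν * baseKer Q b w))) atTop (𝓝 B) := by
  intro b hb
  obtain ⟨r, -, rfl⟩ := mem_image.mp hb
  exact exists_tendsto_psum_const_mul _ (exists_tendsto_psum_weight_mul (hQ r) μ ν)

end Junction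

/-! ## §2 The reduced gluon piece -/

section Gluon

variable (n : ℕ) [NeZero n] (a : ℝ) {S : StencilR} {Wf : Table₂R} {Cs C2 δ : ℝ}

/-- [folklore] **SLOT (F) FOR THE REDUCED GLUON KERNEL `TOfRed n a S (tableRed n Wf)`** GIVEN VERBATIM the hypotheses of leaf-01's A4 END
`ReducedKernelSandwich.secondMoment_TOfRed_eq`: leg binder `Spr (Ga n a)`, bi-localised / fine-translation covariant stencils `S`, bi-localised /
jointly covariant / symmetric second-order table `Wf`, the Ward rows `hrow` and the base-point-summed first moments `hT1` of `fineHess`.  The fine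
integrand at base point `b` is `w ↦ n⁻⁸·w_μw_ν·baseKer (fineHess n a S Wf μ ν) b w`. -/
theorem hF_TOfRed (hn : 1 ≤ n) (hGa : Spr (Ga n a)) (hS : ∀ κ' u, BiLoc (S κ' u) u u Cs δ)
    (hW : ∀ κ' u l' u', BiLoc (Wf κ' u l' u') u u' C2 δ) (hδ : 0 < δ)
    (hScov : ∀ (κ' : Fin 4) (u v : Site 4), S κ' (u + v) = shiftK (-v) (S κ' u))
    (hWcov : ∀ (κ' : Fin 4) (u : Site 4) (l' : Fin 4) (u' v : Site 4), Wf κ' (u + v) l' (u' + v) = shiftK (-v) (Wf κ' u l' u'))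
    (hWsymm : ∀ (κ' : Fin 4) (u : Site 4) (l' : Fin 4) (u' : Site 4), Wf κ' u l' u' = Wf l' u' κ' u)
    (hrow : ∀ (κ' l' : Fin 4) (b : Site 4), HasSum (fineHess n a S Wf κ' l' b) 0)
    (hT1 : ∀ (κ' l' μ' : Fin 4), ∑ r : Fin 4 → Fin n, ∑' t, (t μ' : ℝ) * baseKer (fineHess n a S Wf κ' l') (resSite r) t = 0)
    (μ ν : Fin 4) :
    B12Beta.secondMoment (TOfRed n a S (tableRed n Wf)) μ ν =
      ∑ b ∈ (univ : Finset (Fin 4 → Fin n)).image resSite, ((n : ℝ) ^ 4)⁻¹ *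
        fullSum (fun w : Pt => ((n : ℝ) ^ 8)⁻¹ * (toReal w μ * toReal w ν * baseKer (fineHess n a S Wf μ ν) b w)) :=
  secondMoment_eq_avg_fullSum (secondMoment_TOfRed_eq n a hn hGa hS hW hδ hScov hWcov hWsymm hrow hT1 μ ν μ ν)
    fun r => absMoment₂_baseKer_fineHess n a hGa hS hW hδ μ ν (resSite r)

/-- [folklore] **SLOT (CONV) FOR THE REDUCED GLUON KERNEL** from the leg binder and the localisation sockets ONLY (no Ward / parity input). -/
theorem conv_TOfRed (hGa : Spr (Ga n a)) (hS : ∀ κ' u, BiLoc (S κ' u) u u Cs δ)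
    (hW : ∀ κ' u l' u', BiLoc (Wf κ' u l' u') u u' C2 δ) (hδ : 0 < δ) (μ ν : Fin 4) :
    ∀ b ∈ (univ : Finset (Fin 4 → Fin n)).image resSite,
      ∃ B, Tendsto (psum (fun w : Pt => ((n : ℝ) ^ 8)⁻¹ * (toReal w μ * toReal w ν * baseKer (fineHess n a S Wf μ ν) b w))) atTop (𝓝 B) :=
  conv_of_absMoment₂ (fun r => absMoment₂_baseKer_fineHess n a hGa hS hW hδ μ ν (resSite r)) μ ν

end Gluon

/-! ## §3 The ghost piece of record `PghQ` -/

section Ghost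

variable (n : ℕ) [NeZero n] (a x₀ cK cQ : ℝ)

/-- [folklore] The base-point kernels of the completed fine ghost Hessian kernel are absolutely second-moment summable (`0 < a`; all weights):
`Spr (Ggh n a)` (`GhostLeg.spr_Ggh`) and the two centred-root sockets at the common rate `1/n`. -/
theorem absMoment₂_baseKer_fineHessGhQ (ha : 0 < a) (κ' l' : Fin 4) (b : Site 4) :
    AbsMoment₂ (baseKer (fineHessGhQ n a x₀ cK cQ κ' l') b) := by
  have hn : (0 : ℝ) < 1 / (n : ℝ) := div_pos one_pos (by exact_mod_cast Nat.pos_of_ne_zero (NeZero.ne n))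
  rw [fineHessGhQ_eq]
  exact absMoment₂_baseKer_fineHessA (Ggh n a) (spr_Ggh n a ha) (biLoc_SghAt_ctr n cK cQ) (biLoc_WghAt_ctr n x₀ cK cQ) hn κ' l' b

/-- [folklore] **SLOT (CONV) FOR THE GHOST PIECE OF RECORD**, all weights, `0 < a` only. -/
theorem conv_PghQ (ha : 0 < a) (μ ν : Fin 4) :
    ∀ b ∈ (univ : Finset (Fin 4 → Fin n)).image resSite,
      ∃ B, Tendsto (psum (fun w : Pt => ((n : ℝ) ^ 8)⁻¹ * (toReal w μ * toReal w ν * baseKer (fineHessGhQ n a x₀ cK cQ μ ν) b w)))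
        atTop (𝓝 B) :=
  conv_of_absMoment₂ (fun r => absMoment₂_baseKer_fineHessGhQ n a x₀ cK cQ ha μ ν (resSite r)) μ ν

/-- [folklore] **SLOT (F) FOR THE GHOST PIECE OF RECORD, ALL WEIGHTS, GIVEN THE WARD ROWS** (`Odd n`, `0 < a`; parity is discharged by the
inversion law inside `GhostKernelComplete.bondSecondMoment_PghQ_eq_avgM2_of_wardRows`). -/
theorem hF_PghQ_of_wardRows (ha : 0 < a) (hodd : Odd n)
    (hrow : ∀ (κ' l' : Fin 4) (b : Site 4), HasSum (fineHessGhQ n a x₀ cK cQ κ' l' b) 0) (μ ν : Fin 4) :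
    B12Beta.secondMoment (PghQ n a x₀ cK cQ) μ ν =
      ∑ b ∈ (univ : Finset (Fin 4 → Fin n)).image resSite, ((n : ℝ) ^ 4)⁻¹ *
        fullSum (fun w : Pt => ((n : ℝ) ^ 8)⁻¹ * (toReal w μ * toReal w ν * baseKer (fineHessGhQ n a x₀ cK cQ μ ν) b w)) := by
  refine secondMoment_eq_avg_fullSum ?_ fun r => absMoment₂_baseKer_fineHessGhQ n a x₀ cK cQ ha μ ν (resSite r)
  have hn : (n : ℝ) ≠ 0 := by exact_mod_cast NeZero.ne n
  have h8 : ((n : ℝ) ^ 8)⁻¹ * (n : ℝ) ^ 8 = 1 := inv_mul_cancel₀ (pow_ne_zero 8 hn)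
  have h := bondSecondMoment_PghQ_eq_avgM2_of_wardRows n a x₀ cK cQ ha hodd hrow μ ν μ ν
  have hre : ∀ z : Site 4, PghQ n a x₀ cK cQ μ ν z * (z μ : ℝ) * (z ν : ℝ)
      = ((n : ℝ) ^ 8)⁻¹ * (((z μ * z ν : ℤ) : ℝ) * ((n : ℝ) ^ 8 * PghQ n a x₀ cK cQ μ ν z)) := by
    intro z
    rw [Int.cast_mul]
    linear_combination (-(PghQ n a x₀ cK cQ μ ν z * (z μ : ℝ) * (z ν : ℝ))) * h8
  rw [tsum_congr hre, tsum_mul_left, h]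

/-- [folklore] **SLOT (F) FOR THE GHOST PIECE OF RECORD ON ITS WARD RAY — NO HYPOTHESIS BEYOND `Odd n`, `0 < a`** (every real `c`):
the (1.22)-moment of `PghQ n a (−c) (c·n²) (c·a)` IS the uniform base-point average over `[0,n)⁴` of the punctured full sums of
`w ↦ n⁻⁸·w_μw_ν·baseKer (fineHessGhQ n a (−c) (c·n²) (c·a) μ ν) b w`.  For this piece the slots (F)/(CONV) of A7 are CLOSED in the tree. -/
theorem hF_PghQ_ray (hodd : Odd n) (ha : 0 < a) (c : ℝ) (μ ν : Fin 4) :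
    B12Beta.secondMoment (PghQ n a (-c) (c * (n : ℝ) ^ 2) (c * a)) μ ν =
      ∑ b ∈ (univ : Finset (Fin 4 → Fin n)).image resSite, ((n : ℝ) ^ 4)⁻¹ *
        fullSum (fun w : Pt => ((n : ℝ) ^ 8)⁻¹ *
          (toReal w μ * toReal w ν * baseKer (fineHessGhQ n a (-c) (c * (n : ℝ) ^ 2) (c * a) μ ν) b w)) :=
  secondMoment_eq_avg_fullSum (secondMoment_PghQ_ray_eq n a hodd ha c μ ν μ ν)
    fun r => absMoment₂_baseKer_fineHessGhQ n a (-c) (c * (n : ℝ) ^ 2) (c * a) ha μ ν (resSite r)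

end Ghost

end Summit.QuantumFields.BalabanUV.Beta.D1BFx.AssemblySlots
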